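import Summits.QuantumFields.YangMills.Theorems.MirrorModularBoostsSoftKernelBoostCovarianceDiagGrowthT
import Summits.QuantumFields.YangMills.Theorems.MirrorModularBoostsSoftKernelBoostCovarianceDiagEngine
import Summits.QuantumFields.YangMills.Theorems.MirrorModularBoostsSoftKernelBoostCovarianceDiagOfBoxes
import Summits.QuantumFields.YangMills.Theorems.MirrorModularBoostsSoftKernelBoostCovariancePlanarInvariantOfInputsWeak
import Summits.QuantumFields.YangMills.Theorems.MirrorModularBoostsSoftKernelBoostCovarianceStepZeroByDegrees
import Summits.QuantumFields.YangMills.Theorems.MirrorModularBoostsSoftKernelBoostCovarianceOfInputs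
import Summits.QuantumFields.YangMills.Theorems.MirrorModularBoostsSoftKernelBoostCovarianceBelowThresholdOfSoftKernel
import Summits.QuantumFields.YangMills.Theorems.PencilRigidityNPointIsotropyFrameTransport
import Summits.QuantumFields.YangMills.Theorems.IsotropyFromPowerCountingCurvatureSandwichBoundChainGrowthIff
import Summits.QuantumFields.YangMills.Theorems.CurvatureSandwichBound.Negative.Unbundled
import HarnessLib

/-!
# `SoftKernelBoostCovariance` from the AXIS sandwich row and the regularity of the degrees `≥ 3`

Line `Sketch` of crux `MirrorModularBoosts.SoftKernelBoostCovariance` (stmt-QuantumFields-14999;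
route-QuantumFields-MirrorModularBoosts), skeleton v3.12 (lead c13) / v3.13 (lead c14): the CLOSING COMPOSITION of the line as an
importable theorem, registered stub `stub_cruxOfAxisRow`.

After v3.12 the skeleton `Cruxes/SoftKernelBoostCovariance/Lines/Sketch.lean` (2051 lines, never landable whole) is sorry-free except
for two Yang–Mills inputs: `stub_regularHigh` (for `n ≥ 3`, `𝔖ₙ|⁰𝒮` is integration against a function) and `stub_sandwichAxis` (the
AXIS heat-sandwich row `SandwichRows S₁`, i.e. the first row of item `IsotropyFromPowerCounting.CurvatureSandwichBound`,
stmt-QuantumFields-18372).  The `45°` row that the landed pointwise composition `cruxOfInputsKWeak` (p143258) still asks for is DERIVED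
here, model-blindly given `NPointRegular`, from the axis row by the landed diagonal-chain stubs (G) `stub_diagGrowthT` (p162400),
(E) `stub_diagEngine` (p158796), (F) `stub_diagOfBoxes` (p160140):

* `sandwichBound_mono` — the row is monotone (`μ ↦ max μ 0`, `C ↦ max C 1`);
* `diag_of_axis` — `SandwichBound S₁ h μ C` (`μ ≥ 0`, `C > 0`) + E3 + `NPointRegular S₁` ⇒ `SandwichBound (S₁ ∘ R_{π/4}) h' μ (8·3^μ·C)`
  for every `e₀`-reconstruction `h'` of the `45°` pull-back (same exponent);
* `sandwichRows_planeRot_of_axis` — hence `SandwichRows S₁ → SandwichRows (S₁ ∘ R_{π/4})` for symmetric regular families;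
* `stub_cruxOfAxisRow` (REGISTERED) — **the crux from exactly {regularity of the degrees `≥ 3`, the axis row}**:
  `cruxOfInputsKWeak ∘ stub_stepZeroByDegrees` fed with the pair `⟨axis row, diag_of_axis⟩`;
* by-name adapters for the successor who lands the closing file: `softKernelBoostCovariance_of_regularHigh_of_item'` (the item Σ,
  stmt-18372, its axis row only), `softKernelBoostCovariance_of_items'` (items T = `TemperedCurvatureMoments`, stmt-17721, and Σ),
  `axisRows_of_chainGrowthAxis` / `softKernelBoostCovariance_of_regularHigh_of_chainGrowthAxis` (the Σ-lead's registered leaf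
  `stub_chainGrowthAxis`, verbatim, through the landed engine `sandwich_of_chainGrowth`), and `nPointIsotropyBelowThreshold_of_axisRow`
  (the sibling crux stmt-16180 through the landed `stub_belowThresholdOfSoftKernel`).

Consequence (kernel-checked here, importable): crux stmt-14999 and stmt-16180 depend on route `IsotropyFromPowerCounting` only through
{the AXIS row of stmt-18372 (equivalently its lead's `stub_chainGrowthAxis`), the degree-`≥ 3` regularity (stmt-17721 or stmt-17723)};
the diagonal leaf `stub_chainGrowthDiag` is not consumed.
-/

noncomputable section

namespace Summit.QuantumFields.YangMills.Theorems.SoftKernelBoostCovariance.Sketch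

open scoped BigOperators SchwartzMap InnerProductSpace
open MeasureTheory Filter Topology
open Literature.MathematicalPhysics.QuantumLattice Literature.MathematicalPhysics.AQFT
  Literature.MathematicalPhysics.QuantumFieldTheory
open Summit.QuantumFields.YangMills.Theorems.NPointIsotropy.Negative (E4 NPointRegular)
open Summit.QuantumFields.YangMills.Theorems.CurvatureBoostCovariance.Negative
  (OSPackage Translations Hypercubic EightFrameRP PlanarCone PlanarInvariant Tie Gaps W1)
open Summit.QuantumFields.YangMills.Theorems.CurvatureBoostCovariance.BoostsInheritMirrors.RayPositivity (osReconstruction_of)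
open Summit.QuantumFields.YangMills.Theorems.CurvatureSandwichBound.Negative (SandwichBound SandwichRows)
open Summit.QuantumFields.YangMills.Theorems.CurvatureSandwichBound.Sketch
  (sandwich_of_chainGrowth tsupport_subset_window pairScale_nonneg re_pairing_self_eq_norm_sq)
open Summit.QuantumFields.YangMills.Theorems.NPointIsotropy.QuarterTurnCornerOperator (FrameTransport.nPointRegular_pullBack)

/-! ## The 45° row from the axis row (v3.12 glue) -/

/-- **The rows are monotone**: exponent `μ ↦ max μ 0` and constant `C ↦ max C 1` (reserves `u, v ≤ 1`, nonnegative masses;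
`sandwich_mono_exponent`, p135724). -/
theorem sandwichBound_mono {S₁ : SchwingerFamily E4} (h : OSReconstructionNoE1 S₁.toLabelled) {μ C : ℝ}
    (hSB : SandwichBound S₁ h μ C) : SandwichBound S₁ h (max μ 0) (max C 1) := by
  have h1 := sandwich_mono_exponent h hSB
  intro u v hu hv hu1 hv1 f₁ g hh Mg Mh Mh' hf hg hgi hgM hhi hhM hhM' n W hW hFW
  have h0 := h1 u v hu hv hu1 hv1 f₁ g hh Mg Mh Mh' hf hg hgi hgM hhi hhM hhM' n W hW hFW
  have hMg0 : 0 ≤ Mg := (integral_nonneg fun _ => norm_nonneg _).trans hgM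
  have hMh0 : 0 ≤ Mh := (integral_nonneg fun _ => norm_nonneg _).trans hhM
  have hMh'0 : 0 ≤ Mh' := (norm_nonneg _).trans (hhM' 0)
  have hr : 0 ≤ u ^ (-max μ 0) + v ^ (-max μ 0) := add_nonneg (Real.rpow_nonneg hu.le _) (Real.rpow_nonneg hv.le _)
  have hX : 0 ≤ Mg * (Mh + Mh') * (u ^ (-max μ 0) + v ^ (-max μ 0)) * ‖h.fieldVec n (fun _ => ()) W hW‖ := by positivity
  calc _ ≤ C * Mg * (Mh + Mh') * (u ^ (-max μ 0) + v ^ (-max μ 0)) * ‖h.fieldVec n (fun _ => ()) W hW‖ := h0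
    _ = C * (Mg * (Mh + Mh') * (u ^ (-max μ 0) + v ^ (-max μ 0)) * ‖h.fieldVec n (fun _ => ()) W hW‖) := by ring
    _ ≤ max C 1 * (Mg * (Mh + Mh') * (u ^ (-max μ 0) + v ^ (-max μ 0)) * ‖h.fieldVec n (fun _ => ()) W hW‖) :=
        mul_le_mul_of_nonneg_right (le_max_left _ _) hX
    _ = _ := by ring

/-- **THE 45° ROW FROM THE AXIS ROW** (composition of the landed (G) `stub_diagGrowthT`, (E) `stub_diagEngine`, (F) `stub_diagOfBoxes`;
model-blind given `NPointRegular`).  For `S₁` with an `e₀`-reconstruction `h`, E3, the function residual and the axis bound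
`SandwichBound S₁ h μ C` (`μ ≥ 0`, `C > 0`): every `e₀`-reconstruction `h'` of the `45°` pull-back `n ↦ 𝔖ₙ ∘ (R_{π/4}·)` satisfies
`SandwichBound _ h' μ (8·3^μ·C)` — the SAME exponent.  Box insertions: the diagonal chain moments are `e₀`-pairings of the two readings
`(PᴺW)∘R^{∓1}` whose unordered norms grow like `K·Λ^{4N}` (G); unordered Cauchy–Schwarz + the multiple-reflection engine give the vector
bound with rate `Λ = 2·3^μ·C·Mg·(Mh+Mh')·(u^{-μ}+v^{-μ})` (E); general insertions and clouds by partition of unity and dominated convergence,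
constant `×4` (F).  The degenerate insertion `hh = 0` is treated apart (`f = 0`, the sandwiched vector vanishes). -/
theorem diag_of_axis (S₁ : SchwingerFamily E4) (h : OSReconstructionNoE1 S₁.toLabelled) (μ C : ℝ) (hμ : 0 ≤ μ) (hC : 0 < C)
    (hE3 : S₁.toLabelled.IsSymmetric) (hreg : NPointRegular S₁) (hSB : SandwichBound S₁ h μ C)
    (h' : OSReconstructionNoE1 (SchwingerFamily.toLabelled
      (fun n => (S₁ n).comp (linActMulti (planeRot (0 : Fin 3) (Real.pi / 4)))))) :
    SandwichBound (fun n => (S₁ n).comp (linActMulti (planeRot (0 : Fin 3) (Real.pi / 4))) : SchwingerFamily E4) h' μ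
      (4 * (2 * (3 : ℝ) ^ μ * C)) := by
  have hCB : 0 ≤ 2 * (3 : ℝ) ^ μ * C := by positivity
  refine stub_diagOfBoxes _ h' (FrameTransport.nPointRegular_pullBack S₁ _ hreg) μ (2 * (3 : ℝ) ^ μ * C) hμ hCB ?_
  intro u v c hu hv hu1 hv1 huc hc2 f g hh Mg Mh Mh' hf hg hgi hgM hMg hhi hhM hhM' n W hW hWc hFW
  have hMh0 : 0 ≤ Mh := (integral_nonneg fun _ => norm_nonneg _).trans hhM
  have hMh'0 : 0 ≤ Mh' := (norm_nonneg _).trans (hhM' 0)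
  have hr : 0 < u ^ (-μ) + v ^ (-μ) := add_pos (Real.rpow_pos_of_pos hu _) (Real.rpow_pos_of_pos hv _)
  rcases (add_nonneg hMh0 hMh'0).eq_or_lt with hdeg | hpos
  · -- degenerate insertion: `hh = 0`, so `f = 0` and the sandwiched vector vanishes
    have hMh'z : Mh' = 0 := le_antisymm (by linarith) hMh'0
    have hhz : ∀ p, hh p = 0 := fun p => norm_le_zero_iff.1 (hMh'z ▸ hhM' p)
    have hf0 : f = 0 := by ext x; rw [hf x, hhz]; simp
    have hX0 : f.appendTensor (translateMulti ((2 * u + v) • EuclideanSpace.single 0 1) W) = 0 := by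
      rw [hf0]; ext x; simp
    have hv0 : ‖h'.fieldVec (1 + n) (fun _ => ())
        (f.appendTensor (translateMulti ((2 * u + v) • EuclideanSpace.single 0 1) W)) hFW‖ = 0 := by
      have hsq := re_pairing_self_eq_norm_sq
        (fun n => (S₁ n).comp (linActMulti (planeRot (0 : Fin 3) (Real.pi / 4)))) h' _ hFW
      have hz : ((osAdjoint (f.appendTensor (translateMulti ((2 * u + v) • EuclideanSpace.single 0 1) W))).appendTensor
          (f.appendTensor (translateMulti ((2 * u + v) • EuclideanSpace.single 0 1) W))) = 0 := by
        rw [hX0]; ext x; simp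
      rw [hz, map_zero, Complex.zero_re] at hsq
      exact pow_eq_zero_iff two_ne_zero |>.1 hsq.symm
    rw [hv0, ← hdeg]
    simp
  · have hΛpos : 0 < 2 * (3 : ℝ) ^ μ * C * Mg * (Mh + Mh') * (u ^ (-μ) + v ^ (-μ)) := by positivity
    set P : (Σ m : ℕ, 𝓢((Fin m → E4), ℂ)) → (Σ m : ℕ, 𝓢((Fin m → E4), ℂ)) := fun Gσ =>
      ⟨1 + (1 + Gσ.1), translateMulti ((2 * u + v) • EuclideanSpace.single 0 1)
        ((osAdjoint f).appendTensor
          (f.appendTensor (translateMulti ((2 * u + v) • EuclideanSpace.single 0 1) Gσ.2)))⟩ with hP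
    have hwin : tsupport (f : (Fin 1 → E4) → ℂ) ⊆ {x | u ≤ x 0 0 ∧ x 0 0 ≤ 2 * u} := by
      refine tsupport_subset_window hf fun p hp => ?_
      have h1 := (hg p hp).1
      have hδ : 0 ≤ min u v / 32 := by positivity
      exact ⟨huc.trans h1.1, h1.2.trans (by linarith)⟩
    obtain ⟨K, hK0, m, hm⟩ := stub_diagGrowthT S₁ h μ C hμ hC hE3 hreg hSB u v c hu hv hu1 hv1 huc hc2 f g hh Mg Mh Mh'
      hf hg hgi hgM hMg hhi hhM hhM' n W hW hWc hFW P hP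
    have key := stub_diagEngine S₁ h hE3 hreg (planeRot (0 : Fin 3) (Real.pi / 4)) h' u v hu hv f hwin _ hΛpos n W hW hFW P hP
      ⟨K, hK0, m, fun N hN => by
        obtain ⟨h1, h2, h3, h4, h5, h6, h7⟩ := hm N hN
        exact ⟨linActMulti (planeRot (0 : Fin 3) (Real.pi / 4)).symm (P^[N] ⟨n, W⟩).2,
          linActMulti (planeRot (0 : Fin 3) (Real.pi / 4)) (P^[N] ⟨n, W⟩).2, h1, h2, h3, h4, h5, h6, h7⟩⟩
    calc _ ≤ 2 * (3 : ℝ) ^ μ * C * Mg * (Mh + Mh') * (u ^ (-μ) + v ^ (-μ)) * ‖h'.fieldVec n (fun _ => ()) W hW‖ := key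
      _ = _ := by ring

/-- **`SandwichRows` passes to the `45°` pull-back of a symmetric regular family** (exponent `max μ 0 < 4`, constant
`8·3^{max μ 0}·max C 1`), for any `e₀`-reconstruction `h` of `S₁` itself. -/
theorem sandwichRows_planeRot_of_axis {S₁ : SchwingerFamily E4} (h : OSReconstructionNoE1 S₁.toLabelled)
    (hE3 : S₁.toLabelled.IsSymmetric) (hreg : NPointRegular S₁) (hAxis : SandwichRows S₁) :
    SandwichRows (fun n => (S₁ n).comp (linActMulti (planeRot (0 : Fin 3) (Real.pi / 4))) : SchwingerFamily E4) := by
  intro h'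
  obtain ⟨μ, C, hμ4, hSB⟩ := hAxis h
  exact ⟨max μ 0, 4 * (2 * (3 : ℝ) ^ (max μ 0) * max C 1), max_lt hμ4 (by norm_num),
    diag_of_axis S₁ h _ _ (le_max_right _ _) (lt_of_lt_of_le one_pos (le_max_right _ _)) hE3 hreg (sandwichBound_mono h hSB) h'⟩

/-! ## The crux from the axis row and the regularity of the degrees `≥ 3` (registered stub) -/

/-- **Stub `stub_cruxOfAxisRow` — THE CLOSING COMPOSITION OF LINE `Sketch` (v3.12/v3.13; model-blind glue over landed pieces).**
IF for every compact simple `G`, `r`, `sch`, `S₁` with `W1 r sch S₁`, the eight planar frames, the planar cone and the kernel triple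
(i) `𝔖ₙ|⁰𝒮` is integration against a function for every `n ≥ 3` (registered `stub_regularHigh`; items stmt-17721 / stmt-17723) and
(ii) the AXIS sandwich row `SandwichRows S₁` holds (registered `stub_sandwichAxis`; the first row of item stmt-18372), THEN
`MirrorModularBoosts.SoftKernelBoostCovariance`.  Proof: Step 0 by degrees (`stub_stepZeroByDegrees`, p142709) gives `NPointRegular S₁`;
the `45°` row follows from the axis row (`diag_of_axis`); the landed pointwise composition with the weak `45°` row (`cruxOfInputsKWeak`,
p143258) concludes. -/
theorem stub_cruxOfAxisRow :
    open Literature.MathematicalPhysics.QuantumLattice Literature.MathematicalPhysics.AQFT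
      Literature.MathematicalPhysics.QuantumFieldTheory
      Summit.QuantumFields.YangMills.Theorems.CurvatureBoostCovariance.Negative
      Summit.QuantumFields.YangMills.Theorems.CurvatureSandwichBound.Negative
      Summit.QuantumFields.YangMills.Theorems.NPointIsotropy.Negative in
    (∀ (G : Type) [Group G] [TopologicalSpace G] [IsTopologicalGroup G] [CompactSpace G]
      [MeasurableSpace G] [BorelSpace G], IsCompactSimpleLieGroup G →
      ∀ (r : LatticeRep G) (sch : SpeciesScheme (YMSpecies G)) (S₁ : SchwingerFamily E4),
        W1 r sch S₁ → EightFrameRP S₁ → PlanarCone S₁ →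
        (∃ (K : E4 → ℝ) (C η : ℝ), 0 < η ∧ ContinuousOn K {x : E4 | x ≠ 0} ∧
          (∀ x : E4, x ≠ 0 → |K x| ≤ C * (1 + ‖x‖ ^ (η - 10))) ∧
          ∀ F : SchwartzMap (Fin 2 → E4) ℂ, IsOffDiagonal F →
            MeasureTheory.Integrable (fun x : Fin 2 → E4 => (K (x 0 - x 1) : ℂ) * F x) ∧
              S₁ 2 F = ∫ x : Fin 2 → E4, (K (x 0 - x 1) : ℂ) * F x) →
        ∀ n : ℕ, 3 ≤ n → ∃ W : (Fin n → E4) → ℂ, ∀ F : SchwartzMap (Fin n → E4) ℂ, IsOffDiagonal F →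
          MeasureTheory.Integrable (fun y : Fin n → E4 => W y * F y) ∧ S₁ n F = ∫ y : Fin n → E4, W y * F y) →
    (∀ (G : Type) [Group G] [TopologicalSpace G] [IsTopologicalGroup G] [CompactSpace G]
      [MeasurableSpace G] [BorelSpace G], IsCompactSimpleLieGroup G →
      ∀ (r : LatticeRep G) (sch : SpeciesScheme (YMSpecies G)) (S₁ : SchwingerFamily E4),
        W1 r sch S₁ → EightFrameRP S₁ → PlanarCone S₁ →
        (∃ (K : E4 → ℝ) (C η : ℝ), 0 < η ∧ ContinuousOn K {x : E4 | x ≠ 0} ∧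
          (∀ x : E4, x ≠ 0 → |K x| ≤ C * (1 + ‖x‖ ^ (η - 10))) ∧
          ∀ F : SchwartzMap (Fin 2 → E4) ℂ, IsOffDiagonal F →
            MeasureTheory.Integrable (fun x : Fin 2 → E4 => (K (x 0 - x 1) : ℂ) * F x) ∧
              S₁ 2 F = ∫ x : Fin 2 → E4, (K (x 0 - x 1) : ℂ) * F x) →
        SandwichRows S₁) →
    Summit.QuantumFields.YangMills.Theses.MirrorModularBoosts.SoftKernelBoostCovariance := by
  intro hHigh hAxis
  refine cruxOfInputsKWeak (stub_stepZeroByDegrees hHigh) fun G _ _ _ _ _ _ hG r sch S₁ hW h8 hC hK => ?_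
  have hreg : NPointRegular S₁ := stub_stepZeroByDegrees hHigh G hG r sch S₁ hW h8 hC hK
  obtain ⟨_, hOS, htr, -, -⟩ := id hW
  have hRows : SandwichRows S₁ := hAxis G hG r sch S₁ hW h8 hC hK
  have h : OSReconstructionNoE1 S₁.toLabelled := osReconstruction_of hOS.2.2.2.1 htr
  have h45 := sandwichRows_planeRot_of_axis h hOS.2.2.2.2.1 hreg hRows
  exact ⟨fun h₀ => hRows h₀, fun h' => let ⟨μ, C, _, hSB⟩ := h45 h'; ⟨μ, C, hSB⟩⟩

/-! ## By-name adapters: the items, the Σ-lead's axis leaf, the sibling crux -/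

/-- **The crux from the regularity residual and the ITEM Σ, using its AXIS row only** (`CurvatureSandwichBound`, stmt-18372; its
`45°` row is discarded — compare `softKernelBoostCovariance_of_regularHigh_of_sandwich`, p142709, which used both rows). -/
theorem softKernelBoostCovariance_of_regularHigh_of_item'
    (hHigh : open Literature.MathematicalPhysics.QuantumLattice Literature.MathematicalPhysics.AQFT
      Literature.MathematicalPhysics.QuantumFieldTheory
      Summit.QuantumFields.YangMills.Theorems.CurvatureBoostCovariance.Negative
      Summit.QuantumFields.YangMills.Theorems.NPointIsotropy.Negative in
    ∀ (G : Type) [Group G] [TopologicalSpace G] [IsTopologicalGroup G] [CompactSpace G]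
      [MeasurableSpace G] [BorelSpace G], IsCompactSimpleLieGroup G →
      ∀ (r : LatticeRep G) (sch : SpeciesScheme (YMSpecies G)) (S₁ : SchwingerFamily E4),
        W1 r sch S₁ → EightFrameRP S₁ → PlanarCone S₁ →
        (∃ (K : E4 → ℝ) (C η : ℝ), 0 < η ∧ ContinuousOn K {x : E4 | x ≠ 0} ∧
          (∀ x : E4, x ≠ 0 → |K x| ≤ C * (1 + ‖x‖ ^ (η - 10))) ∧
          ∀ F : SchwartzMap (Fin 2 → E4) ℂ, IsOffDiagonal F →
            MeasureTheory.Integrable (fun x : Fin 2 → E4 => (K (x 0 - x 1) : ℂ) * F x) ∧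
              S₁ 2 F = ∫ x : Fin 2 → E4, (K (x 0 - x 1) : ℂ) * F x) →
        ∀ n : ℕ, 3 ≤ n → ∃ W : (Fin n → E4) → ℂ, ∀ F : SchwartzMap (Fin n → E4) ℂ, IsOffDiagonal F →
          MeasureTheory.Integrable (fun y : Fin n → E4 => W y * F y) ∧ S₁ n F = ∫ y : Fin n → E4, W y * F y)
    (hSig : Summit.QuantumFields.YangMills.Theses.IsotropyFromPowerCounting.CurvatureSandwichBound) :
    Summit.QuantumFields.YangMills.Theses.MirrorModularBoosts.SoftKernelBoostCovariance :=
  stub_cruxOfAxisRow hHigh fun G _ _ _ _ _ _ hG r sch S₁ hW h8 hC hK =>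
    ((Summit.QuantumFields.YangMills.Theorems.CurvatureSandwichBound.Negative.curvatureSandwichBound_iff.1 hSig)
      G hG r sch S₁ hW h8 hC hK).1

/-- **The crux from the two ITEMS, Σ through its axis row only**: `TemperedCurvatureMoments` (T, stmt-17721; `regularHigh_of_temperedCurvatureMoments`,
p142709) and `CurvatureSandwichBound` (Σ, stmt-18372).  The by-name closing recipe of the line when both `…_holds` theorems exist. -/
theorem softKernelBoostCovariance_of_items'
    (hT : Summit.QuantumFields.YangMills.Theses.IsotropyFromPowerCounting.TemperedCurvatureMoments)
    (hSig : Summit.QuantumFields.YangMills.Theses.IsotropyFromPowerCounting.CurvatureSandwichBound) :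
    Summit.QuantumFields.YangMills.Theses.MirrorModularBoosts.SoftKernelBoostCovariance :=
  softKernelBoostCovariance_of_regularHigh_of_item' (regularHigh_of_temperedCurvatureMoments hT) hSig

/-- **The Σ-lead's axis leaf gives the axis row**: the registered Yang–Mills stub `stub_chainGrowthAxis` of crux stmt-18372's line
`Sketch` (normalised chain growth at the pair scale in the axis frame, taken verbatim as a hypothesis) implies `SandwichRows S₁` under the
crux hypotheses, through the landed multiple-reflection engine `sandwich_of_chainGrowth` (p146381) with `C_W = ‖Ψ_W‖²` — the axis half of
`curvatureSandwichBound_of_chainGrowth` (p146704). -/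
theorem axisRows_of_chainGrowthAxis
    (hAxis : ∀ (G : Type) [Group G] [TopologicalSpace G] [IsTopologicalGroup G] [CompactSpace G]
        [MeasurableSpace G] [BorelSpace G], IsCompactSimpleLieGroup G →
      ∀ (r : LatticeRep G) (sch : SpeciesScheme (YMSpecies G)) (S₁ : SchwingerFamily E4),
        W1 r sch S₁ → EightFrameRP S₁ → PlanarCone S₁ →
        (∃ (K : E4 → ℝ) (C η : ℝ), 0 < η ∧ ContinuousOn K {x : E4 | x ≠ 0} ∧
          (∀ x : E4, x ≠ 0 → |K x| ≤ C * (1 + ‖x‖ ^ (η - 10))) ∧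
          ∀ F : 𝓢((Fin 2 → E4), ℂ), IsOffDiagonal F →
            Integrable (fun x : Fin 2 → E4 => (K (x 0 - x 1) : ℂ) * F x) ∧
              S₁ 2 F = ∫ x : Fin 2 → E4, (K (x 0 - x 1) : ℂ) * F x) →
        OSReconstructionNoE1 S₁.toLabelled →
        ∃ μ C : ℝ, μ < 4 ∧ 0 ≤ C ∧
          ∀ (u v : ℝ), 0 < u → 0 < v → u ≤ 1 → v ≤ 1 →
            ∀ (f₁ : 𝓢((Fin 1 → E4), ℂ)) (g hh : ℝ × ℝ → ℂ) (Mg Mh Mh' : ℝ),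
              (∀ x : Fin 1 → E4, f₁ x = g (x 0 0, x 0 1) * hh (x 0 2, x 0 3)) →
              (∀ p : ℝ × ℝ, g p ≠ 0 → u ≤ p.1 ∧ p.1 ≤ 2 * u) →
              Integrable g → (∫ p, ‖g p‖) ≤ Mg → Integrable hh → (∫ p, ‖hh p‖) ≤ Mh →
              (∀ p, ‖hh p‖ ≤ Mh') →
            ∀ (n : ℕ) (W : 𝓢((Fin n → E4), ℂ)), IsTimeOrdered W →
              IsTimeOrdered (f₁.appendTensor (translateMulti ((2 * u + v) • EuclideanSpace.single 0 1) W)) →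
            ∀ (P : (Σ m : ℕ, 𝓢((Fin m → E4), ℂ)) → (Σ m : ℕ, 𝓢((Fin m → E4), ℂ))),
              (P = fun Gσ => ⟨1 + (1 + Gσ.1), translateMulti ((2 * u + v) • EuclideanSpace.single 0 1)
                ((osAdjoint f₁).appendTensor
                  (f₁.appendTensor (translateMulti ((2 * u + v) • EuclideanSpace.single 0 1) Gσ.2)))⟩) →
            ∀ N : ℕ,
              (S₁ (n + (P^[N] ⟨n, W⟩).1) ((osAdjoint W).appendTensor (P^[N] ⟨n, W⟩).2)).re ≤
                (S₁ (n + n) ((osAdjoint W).appendTensor W)).re *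
                  (C * Mg * (Mh + Mh') * (u ^ (-μ) + v ^ (-μ))) ^ (2 * N)) :
    ∀ (G : Type) [Group G] [TopologicalSpace G] [IsTopologicalGroup G] [CompactSpace G]
      [MeasurableSpace G] [BorelSpace G], IsCompactSimpleLieGroup G →
      ∀ (r : LatticeRep G) (sch : SpeciesScheme (YMSpecies G)) (S₁ : SchwingerFamily E4),
        W1 r sch S₁ → EightFrameRP S₁ → PlanarCone S₁ →
        (∃ (K : E4 → ℝ) (C η : ℝ), 0 < η ∧ ContinuousOn K {x : E4 | x ≠ 0} ∧
          (∀ x : E4, x ≠ 0 → |K x| ≤ C * (1 + ‖x‖ ^ (η - 10))) ∧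
          ∀ F : SchwartzMap (Fin 2 → E4) ℂ, IsOffDiagonal F →
            MeasureTheory.Integrable (fun x : Fin 2 → E4 => (K (x 0 - x 1) : ℂ) * F x) ∧
              S₁ 2 F = ∫ x : Fin 2 → E4, (K (x 0 - x 1) : ℂ) * F x) →
        SandwichRows S₁ := by
  intro G _ _ _ _ _ _ hG r sch S₁ hW1 h8 hC hK h
  obtain ⟨μ, C, hμ, hC0, hrow⟩ := hAxis G hG r sch S₁ hW1 h8 hC hK h
  refine ⟨μ, C, hμ, ?_⟩
  intro u v hu hv hu1 hv1 f₁ g hh Mg Mh Mh' hf₁ hg hgi hMg hhi hMh hMh' n W hW hFW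
  have hCW := hrow u v hu hv hu1 hv1 f₁ g hh Mg Mh Mh' hf₁ hg hgi hMg hhi hMh hMh' n W hW hFW _ rfl
  exact sandwich_of_chainGrowth S₁ h u v hu hv f₁ (tsupport_subset_window hf₁ hg) _
    (pairScale_nonneg hC0 hu hv hMg hMh hMh') W hW hFW _
    ((re_pairing_self_eq_norm_sq S₁ h W hW).symm ▸ sq_nonneg _) _ rfl hCW

/-- **The crux from the regularity residual and the Σ-lead's axis leaf** (`stub_chainGrowthAxis` of stmt-18372, verbatim): the
kernel-checked dependency of stmt-14999 on route `IsotropyFromPowerCounting` after v3.12 is {`stub_chainGrowthAxis`, degree-`≥ 3`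
regularity} — the diagonal leaf `stub_chainGrowthDiag` is not consumed. -/
theorem softKernelBoostCovariance_of_regularHigh_of_chainGrowthAxis
    (hHigh : open Literature.MathematicalPhysics.QuantumLattice Literature.MathematicalPhysics.AQFT
      Literature.MathematicalPhysics.QuantumFieldTheory
      Summit.QuantumFields.YangMills.Theorems.CurvatureBoostCovariance.Negative
      Summit.QuantumFields.YangMills.Theorems.NPointIsotropy.Negative in
    ∀ (G : Type) [Group G] [TopologicalSpace G] [IsTopologicalGroup G] [CompactSpace G]
      [MeasurableSpace G] [BorelSpace G], IsCompactSimpleLieGroup G →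
      ∀ (r : LatticeRep G) (sch : SpeciesScheme (YMSpecies G)) (S₁ : SchwingerFamily E4),
        W1 r sch S₁ → EightFrameRP S₁ → PlanarCone S₁ →
        (∃ (K : E4 → ℝ) (C η : ℝ), 0 < η ∧ ContinuousOn K {x : E4 | x ≠ 0} ∧
          (∀ x : E4, x ≠ 0 → |K x| ≤ C * (1 + ‖x‖ ^ (η - 10))) ∧
          ∀ F : SchwartzMap (Fin 2 → E4) ℂ, IsOffDiagonal F →
            MeasureTheory.Integrable (fun x : Fin 2 → E4 => (K (x 0 - x 1) : ℂ) * F x) ∧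
              S₁ 2 F = ∫ x : Fin 2 → E4, (K (x 0 - x 1) : ℂ) * F x) →
        ∀ n : ℕ, 3 ≤ n → ∃ W : (Fin n → E4) → ℂ, ∀ F : SchwartzMap (Fin n → E4) ℂ, IsOffDiagonal F →
          MeasureTheory.Integrable (fun y : Fin n → E4 => W y * F y) ∧ S₁ n F = ∫ y : Fin n → E4, W y * F y)
    (hAxis : ∀ (G : Type) [Group G] [TopologicalSpace G] [IsTopologicalGroup G] [CompactSpace G]
        [MeasurableSpace G] [BorelSpace G], IsCompactSimpleLieGroup G →
      ∀ (r : LatticeRep G) (sch : SpeciesScheme (YMSpecies G)) (S₁ : SchwingerFamily E4),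
        W1 r sch S₁ → EightFrameRP S₁ → PlanarCone S₁ →
        (∃ (K : E4 → ℝ) (C η : ℝ), 0 < η ∧ ContinuousOn K {x : E4 | x ≠ 0} ∧
          (∀ x : E4, x ≠ 0 → |K x| ≤ C * (1 + ‖x‖ ^ (η - 10))) ∧
          ∀ F : 𝓢((Fin 2 → E4), ℂ), IsOffDiagonal F →
            Integrable (fun x : Fin 2 → E4 => (K (x 0 - x 1) : ℂ) * F x) ∧
              S₁ 2 F = ∫ x : Fin 2 → E4, (K (x 0 - x 1) : ℂ) * F x) →
        OSReconstructionNoE1 S₁.toLabelled →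
        ∃ μ C : ℝ, μ < 4 ∧ 0 ≤ C ∧
          ∀ (u v : ℝ), 0 < u → 0 < v → u ≤ 1 → v ≤ 1 →
            ∀ (f₁ : 𝓢((Fin 1 → E4), ℂ)) (g hh : ℝ × ℝ → ℂ) (Mg Mh Mh' : ℝ),
              (∀ x : Fin 1 → E4, f₁ x = g (x 0 0, x 0 1) * hh (x 0 2, x 0 3)) →
              (∀ p : ℝ × ℝ, g p ≠ 0 → u ≤ p.1 ∧ p.1 ≤ 2 * u) →
              Integrable g → (∫ p, ‖g p‖) ≤ Mg → Integrable hh → (∫ p, ‖hh p‖) ≤ Mh →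
              (∀ p, ‖hh p‖ ≤ Mh') →
            ∀ (n : ℕ) (W : 𝓢((Fin n → E4), ℂ)), IsTimeOrdered W →
              IsTimeOrdered (f₁.appendTensor (translateMulti ((2 * u + v) • EuclideanSpace.single 0 1) W)) →
            ∀ (P : (Σ m : ℕ, 𝓢((Fin m → E4), ℂ)) → (Σ m : ℕ, 𝓢((Fin m → E4), ℂ))),
              (P = fun Gσ => ⟨1 + (1 + Gσ.1), translateMulti ((2 * u + v) • EuclideanSpace.single 0 1)
                ((osAdjoint f₁).appendTensor
                  (f₁.appendTensor (translateMulti ((2 * u + v) • EuclideanSpace.single 0 1) Gσ.2)))⟩) →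
            ∀ N : ℕ,
              (S₁ (n + (P^[N] ⟨n, W⟩).1) ((osAdjoint W).appendTensor (P^[N] ⟨n, W⟩).2)).re ≤
                (S₁ (n + n) ((osAdjoint W).appendTensor W)).re *
                  (C * Mg * (Mh + Mh') * (u ^ (-μ) + v ^ (-μ))) ^ (2 * N)) :
    Summit.QuantumFields.YangMills.Theses.MirrorModularBoosts.SoftKernelBoostCovariance :=
  stub_cruxOfAxisRow hHigh (axisRows_of_chainGrowthAxis hAxis)

/-- **The sibling crux from the same two inputs**: `CertificationLength.NPointIsotropyBelowThreshold` (stmt-QuantumFields-16180) from the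
regularity residual and the axis row, through `stub_cruxOfAxisRow` and the landed `stub_belowThresholdOfSoftKernel` (p138346). -/
theorem nPointIsotropyBelowThreshold_of_axisRow
    (hHigh : open Literature.MathematicalPhysics.QuantumLattice Literature.MathematicalPhysics.AQFT
      Literature.MathematicalPhysics.QuantumFieldTheory
      Summit.QuantumFields.YangMills.Theorems.CurvatureBoostCovariance.Negative
      Summit.QuantumFields.YangMills.Theorems.NPointIsotropy.Negative in
    ∀ (G : Type) [Group G] [TopologicalSpace G] [IsTopologicalGroup G] [CompactSpace G]
      [MeasurableSpace G] [BorelSpace G], IsCompactSimpleLieGroup G →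
      ∀ (r : LatticeRep G) (sch : SpeciesScheme (YMSpecies G)) (S₁ : SchwingerFamily E4),
        W1 r sch S₁ → EightFrameRP S₁ → PlanarCone S₁ →
        (∃ (K : E4 → ℝ) (C η : ℝ), 0 < η ∧ ContinuousOn K {x : E4 | x ≠ 0} ∧
          (∀ x : E4, x ≠ 0 → |K x| ≤ C * (1 + ‖x‖ ^ (η - 10))) ∧
          ∀ F : SchwartzMap (Fin 2 → E4) ℂ, IsOffDiagonal F →
            MeasureTheory.Integrable (fun x : Fin 2 → E4 => (K (x 0 - x 1) : ℂ) * F x) ∧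
              S₁ 2 F = ∫ x : Fin 2 → E4, (K (x 0 - x 1) : ℂ) * F x) →
        ∀ n : ℕ, 3 ≤ n → ∃ W : (Fin n → E4) → ℂ, ∀ F : SchwartzMap (Fin n → E4) ℂ, IsOffDiagonal F →
          MeasureTheory.Integrable (fun y : Fin n → E4 => W y * F y) ∧ S₁ n F = ∫ y : Fin n → E4, W y * F y)
    (hAxis : open Literature.MathematicalPhysics.QuantumLattice Literature.MathematicalPhysics.AQFT
      Literature.MathematicalPhysics.QuantumFieldTheory
      Summit.QuantumFields.YangMills.Theorems.CurvatureBoostCovariance.Negative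
      Summit.QuantumFields.YangMills.Theorems.CurvatureSandwichBound.Negative
      Summit.QuantumFields.YangMills.Theorems.NPointIsotropy.Negative in
    ∀ (G : Type) [Group G] [TopologicalSpace G] [IsTopologicalGroup G] [CompactSpace G]
      [MeasurableSpace G] [BorelSpace G], IsCompactSimpleLieGroup G →
      ∀ (r : LatticeRep G) (sch : SpeciesScheme (YMSpecies G)) (S₁ : SchwingerFamily E4),
        W1 r sch S₁ → EightFrameRP S₁ → PlanarCone S₁ →
        (∃ (K : E4 → ℝ) (C η : ℝ), 0 < η ∧ ContinuousOn K {x : E4 | x ≠ 0} ∧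
          (∀ x : E4, x ≠ 0 → |K x| ≤ C * (1 + ‖x‖ ^ (η - 10))) ∧
          ∀ F : SchwartzMap (Fin 2 → E4) ℂ, IsOffDiagonal F →
            MeasureTheory.Integrable (fun x : Fin 2 → E4 => (K (x 0 - x 1) : ℂ) * F x) ∧
              S₁ 2 F = ∫ x : Fin 2 → E4, (K (x 0 - x 1) : ℂ) * F x) →
        SandwichRows S₁) :
    Summit.QuantumFields.YangMills.Theses.CertificationLength.NPointIsotropyBelowThreshold :=
  stub_belowThresholdOfSoftKernel (stub_cruxOfAxisRow hHigh hAxis)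

end Summit.QuantumFields.YangMills.Theorems.SoftKernelBoostCovariance.Sketch

end
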